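import Summits.CriticalPhenomena.PercolationContinuityZ3.Theorems.Transplant.SkelPhiFaceRouteInputs4YFC
import Summits.CriticalPhenomena.PercolationContinuityZ3.Theorems.Transplant.SkelPhiRootBridgeKitsFCQ
import Summits.CriticalPhenomena.PercolationContinuityZ3.Theorems.Transplant.SkelPhiRunKitsFCQ
import HarnessLib
/-!
# WAVE-Q binder row «SkelPhiFaceRouteInputs4YFC» ↦ «SkelPhiFaceRouteInputs4YFCQ» (quasi-step rung (N3-b); captain gen-1 g4, WAVE-Q-BINDER-rows v0.7/v0.8, row Q48, FLOOR row; family stmt-g33 = «SkelPhiCorridor*» / «SkelPhiFace*»):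
# **THE y′-FACE ROUTE FROM THE FOUR KIT INPUTS, UNDER EXACT-FOOTPRINT QUASI-STEPS** — `Skelφ.faceRoute_of_inputs4_yFCQ`

builds on p205010 (kernel theorem, internal audit signed; external expert review pending) — nothing in this file uses p205010; nothing here is a claim about any open node (the
quasi-step node's statement, name and wording are a lead's).  Lane `prim-bschramm`, seat `prim-bschramm-stmt` gen 33 (port pen).  Helper file (`--supports stmt-CriticalPhenomena-4575 --as helper`);
def-free.  PORT RULES (captain #6109/#6122 hunk classes + R-1 = L-hp8-1 (b)): twin of the `hstep`-threading declaration of the tree module «SkelPhiFaceRouteInputs4YFC» (sha256 c0483deb966c4dc7…,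
imported — the Steps-free route law / face route composition are used from it), statement and proof BYTE-IDENTICAL except: (i) `(hstep : Steps G φ) ↦ {M : ℕ} (hqφ :
Skelφ.QStepsN G φ M)` with the two frame-cost floors `hPNb : 1 ≤ Pb.N ↦ M ≤ Pb.N` (bridge/root frame, cost `M`) and `hPNr : kq + 3 ≤ Pr.N ↦ M·(kq+3) ≤ Pr.N` (run frames, cost
`M(kq+3)`); (ii) `hkits_bridgeFC ↦ hkits_bridgeFC_q` («SkelPhiRootBridgeKitsFCQ» Q41, hp-8 g62), `hkits_runXFC / hkits_runYFC ↦ …_q` («SkelPhiRunKitsFCQ» Q42, hp-8 g62); (iv) FLOOR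
tokens (p5-g28's pull list), bridge and run kit constants alike: `KCmax· ↦ P·.N·KCmax·` in `hDw·`, `hT'·`, `hr₀·`, `hrs·`, `hE·`, `hreach·`, `KCmax· + 1 ↦ (KCmax·+1)·(P·.N+2)` in `hcS·`.
Regression: `M = 1`, `P.N`-tokens at `qStepsN_of_steps` give the original.  Docstrings and citations are the original's.
-/


noncomputable section

open MeasureTheory ProbabilityTheory
open scoped ENNReal Classical

namespace Summit.CriticalPhenomena.PercolationContinuityZ3.Theorems.Transplant

namespace Skelφ

open Literature.Probability.Percolation Literature.Probability.LatticeModels SimpleGraph GadgetSystem Contour KNCells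
open Literature.Probability.Percolation.KozmaNitzan.Cells (oth sgOf stepVec_apply_fst)
open KNLevels ChainPlanar
open Literature.Barriers.CriticalPhenomena (graphBall mem_graphBall_self graphBall_mono)
open BoxProdZ2 (ConcRadiiG)
open Skel (winGraph routeW excess)
open SkelI (tanOff)

variable {V : Type} [DecidableEq V] [Countable V] {G : SimpleGraph V} [G.LocallyFinite] {φ ψc : V → Site 2}

/-- **THE ROUTE DATUM OF A FACE-STEP KIT AT A y′-FACE FROM THE INPUTS AT EVERY CENTRE** (see the module docstring).
[cite: KozmaNitzan2024, §4 Lemma 10 (pp. 17–21), Lemma 11 (pp. 22–23), Lemma 12 (pp. 23–25)] -/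
theorem faceRoute_of_inputs4_yFCQ (hlipφ : Lip G φ) {M : ℕ} (hqφ : QStepsN G φ M)
    {Δg : ℕ} (hΔg : ∀ v, G.degree v ≤ Δg)
    -- the face step: law, region, target, zone; the kit centre `c`, inner radius `L`
    {w₀ c : V} {Rπ L : ℕ} {Wt : Sym2 V → unitInterval} {q : unitInterval} {D T Z : Finset V}
    (hWG : ∀ e, e ∉ G.edgeSet → Wt e = 0) (hWD : IsSubbox (winGraph G w₀ Rπ) Wt q D) (hDπ : ∀ u ∈ D, u ∈ graphBall G w₀ Rπ)
    (hcL : c ∈ graphBall G w₀ (Rπ - L)) (hLπ : L ≤ Rπ)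
    {Pl : Finset (Site 2)} {MM : Finset V} (hPlD : Win G ψc w₀ Pl Rπ ⊆ D) (hMT : MM ⊆ T) (hMZ : Disjoint MM Z)
    -- the pinned seed
    {S : Finset V} (hcS : c ∈ S) (hSconn : ∀ s ∈ S, PathIn G (↑S : Set V) c s) (hSD : S ⊆ D) {ρ : ℕ} (hSρ : ∀ s ∈ S, s ∈ graphBall G c ρ)
    (hρL : ρ ≤ L) {σh σ : ℤ} (hσh : σh = 1 ∨ σh = -1) (hσ : σ = 1 ∨ σ = -1) {kb : ℕ} (hSk : ∀ s ∈ S, |rootFrame φ c σh s 0| ≤ kb)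
    -- the bridge frame (hop side `σh`), the along run (y′, sign `σ`) at `cL`, the tangential run (x, sign `σT`) at `cT`, level data
    (B : BridgePrm) (hB : BridgeOK B) {nL : ℕ} (hnL : 1 ≤ nL) (cL cT : V) (hL : ℤ) {kq : ℕ} (hκL : hL.natAbs ≤ kq * nL)
    (ℓ' R's qB Nr Rl : ℕ) {σT vL : ℤ} (hσT : σT = 1 ∨ σT = -1) (hvL : |vL| ≤ nL) (hlay : (nL + hL.natAbs : ℕ) ≤ (nL : ℤ) * ℓ' + 1) (R'₃ qB₃ N₃ : ℕ)
    (Rlev₁ N₁ j₀₁ j₁₁ Rlev₂ N₂ j₀₂ j₁₂ Rlev₃ N₃' j₀₃ j₁₃ : ℕ) (hRl₁ : Rlev₁ + 1 ≤ B.R') (hRl₂ : Rlev₂ + 1 ≤ R's) (hRl₃ : Rlev₃ + 1 ≤ R'₃)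
    (hj₁ : j₁₁ ≤ Rlev₁) (hj₂ : j₁₂ ≤ Rlev₂) (hj₃ : j₁₃ ≤ Rlev₃)
    -- rooms (instantiated; discharged numerically in part R4b)
    (hfoot₁ : ∀ w ∈ graphBall G c L, rootFrame φ c σh w ∈ Finset.Icc B.regionLo B.regionHi → ψc w ∈ Pl)
    (hfoot₂ : ∀ k ≤ Nr, ∀ w ∈ graphBall G c L, runY φ cL nL hL σ w ∈ (yRunSched hnL hvL hlay R's qB Nr).region k → ψc w ∈ Pl)
    (hfoot₃ : ∀ k ≤ N₃, ∀ w ∈ graphBall G c L, runX φ cT nL hL σT w ∈ (xRunSched nL ℓ' hL R'₃ qB₃ N₃).region k → ψc w ∈ Pl)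
    (hclear₁ : (kb : ℤ) < B.B₀lo 0 - B.R' - B.pr)
    (hclear₂ : ∀ k ≤ Nr, ∀ w ∈ graphBall G c L, runY φ cL nL hL σ w ∈ (yRunSched hnL hvL hlay R's qB Nr).region k → w ∉ S)
    (hclear₃ : ∀ k ≤ N₃, ∀ w ∈ graphBall G c L, runX φ cT nL hL σT w ∈ (xRunSched nL ℓ' hL R'₃ qB₃ N₃).region k → w ∉ S)
    (hTne₁ : (Win G (rootFrame φ c σh) c (Finset.Icc B.core1Lo B.core1Hi) L).Nonempty)
    (hTne₂ : ∀ k ≤ Nr, (Win G (runY φ cL nL hL σ) c ((yRunSched hnL hvL hlay R's qB Nr).core (k + 1)) L).Nonempty)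
    (hTne₃ : ∀ k ≤ N₃, (Win G (runX φ cT nL hL σT) c ((xRunSched nL ℓ' hL R'₃ qB₃ N₃).core (k + 1)) L).Nonempty)
    (hx₁₂ : ∀ w ∈ graphBall G c L, rootFrame φ c σh w ∈ Finset.Icc B.core1Lo B.core1Hi → runY φ cL nL hL σ w ∈ (yRunSched hnL hvL hlay R's qB Nr).core 0)
    (hx₂₃ : ∀ w ∈ graphBall G c L, runY φ cL nL hL σ w ∈ (yRunSched hnL hvL hlay R's qB Nr).core (Nr + 1) →
      runX φ cT nL hL σT w ∈ (xRunSched nL ℓ' hL R'₃ qB₃ N₃).core 0)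
    (hlastf : ∀ w ∈ graphBall G c L, runX φ cT nL hL σT w ∈ (xRunSched nL ℓ' hL R'₃ qB₃ N₃).core (N₃ + 1) → w ∈ MM)
    -- the hop at the kit centre
    {U S₀ T₀ : Finset V} (hUD : U ⊆ D) (hUL : ∀ u ∈ U, u ∈ graphBall G c L) (hS₀ : S₀ ⊆ S) (hSU : S ⊆ U)
    (hT₀ : ∀ w ∈ T₀, w ∈ graphBall G c L ∧ rootFrame φ c σh w ∈ Finset.Icc B.B₀lo B.B₀hi) {Δ' : ℕ} {δ ε η : ℝ} (hδ : 0 < δ)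
    (hlink : 1 - δ < (bondPercolation G q).real (linkIn (↑U : Set V) S₀ T₀))
    -- the chain property of the inner window graph at `(δ ↦ ε)`
    (hchain : ∀ (W : Sym2 V → unitInterval) (s : Fin (0 + 1 + Nr + 1 + N₃ + 1) → TStep (winGraph G c L))
      (T' : Fin (0 + 1 + Nr + 1 + N₃ + 1) → Finset V) (η : ℝ),
      (∀ i, (s i).L.o = (s 0).L.o) →
      (∀ i : Fin (0 + 1 + Nr + 1 + N₃), T' (Fin.castSucc i) ⊆ (s i.succ).L.X 0) →
      (∀ i, T' i ⊆ (s i).T) →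
      (∀ i, (s i).KitsAtF W q Δ' δ) →
      η ≤ δ / 2 →
      (∀ i, (prodBernoulli W).real (⋃ t ∈ (s i).T \ T' i, openConn (s 0).L.o t) ≤ η) →
      1 - δ < (prodBernoulli W).real (s 0).L.reachB →
        1 - ε < (prodBernoulli W).real (⋃ t ∈ T' (Fin.last (0 + 1 + Nr + 1 + N₃)), openConn (s 0).L.o t))
    -- counts and the accuracy split
    (hcount₁ : 1 / (1 - (q : ℝ)) ^ (Δ' * N₁) ≤ δ * ((Finset.Icc j₀₁ j₁₁).card : ℝ))
    (hcount₂ : 1 / (1 - (q : ℝ)) ^ (Δ' * N₂) ≤ δ * ((Finset.Icc j₀₂ j₁₂).card : ℝ))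
    (hcount₃ : 1 / (1 - (q : ℝ)) ^ (Δ' * N₃') ≤ δ * ((Finset.Icc j₀₃ j₁₃).card : ℝ))
    (hη : η ≤ δ / 2)
    -- THE KITS: constants of the bridge kit `Pb` and of the run kit `Pr` (both runs), short region, zone family, short pieces
    (Pb Pr : ApronPrm) {Mz Rs KCmaxb KCmaxr rsb rsr cSb cSr cU r₁ r₂ Rb : ℕ}
    (hPNb : M ≤ Pb.N) (hAb : Pb.A = (Mz : ℤ) + 2)
    (hdDb : Pb.d + 2 ≤ shellD Pb) (hDρb : Rs + 1 ≤ shellD Pb) (hKCmaxb : shellD Pb + Mz + 1 ≤ KCmaxb)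
    (hwideb : ∀ j, j₀₁ ≤ j → j ≤ j₁₁ → ∀ i, (B.B₀lo - (j : Site 2)) i + 2 * tanOff Pb.ℓs Pb.M ≤ (B.B₀hi + (j : Site 2)) i)
    (hdwb : ∀ j, j₀₁ ≤ j → j ≤ j₁₁ → ∀ i, (B.B₀lo - (j : Site 2)) i + (Pb.d + 2 : ℕ) ≤ (B.B₀hi + (j : Site 2)) i)
    (hDwb : ∀ j, j₀₁ ≤ j → j ≤ j₁₁ → ∀ i, (B.B₀lo - (j : Site 2)) i + ((shellD Pb + 1 + Pb.d + Pb.N * KCmaxb + Rs : ℕ) : ℤ) ≤ (B.B₀hi + (j : Site 2)) i)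
    (hT'b : (shellD Pb : ℤ) + Pb.N * KCmaxb + Rs ≤ tanOff Pb.ℓs Pb.M)
    (hr₀b : Pb.N * (tanOff Pb.ℓs Pb.M + 2) + Pb.N * Pb.d + (Pb.N * KCmaxb + Rs) ≤ Pb.r₀) (hRb₀ : Pb.r₀ ≤ L)
    (hrsb : 1 + (Pb.N * (tanOff Pb.ℓs Pb.M + 2) + Pb.N * Pb.d + (Pb.N * KCmaxb + Rs)) ≤ rsb)
    (hcSb : (Pb.N + 1) * (tanOff Pb.ℓs Pb.M + 1) + (Pb.N + 1) * Pb.d + (KCmaxb + 1) * (Pb.N + 2) + cU ≤ cSb)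
    (hEb : j₁₁ + (Pb.N * (tanOff Pb.ℓs Pb.M + 1) + Pb.N * Pb.d + Pb.N * KCmaxb) ≤ B.R')
    (hreachb : r₁ + (Pb.N * (tanOff Pb.ℓs Pb.M + 1) + Pb.N * Pb.d + Pb.N * KCmaxb) ≤ Pb.r₀) (hr₁ : Rb ≤ r₁) (hr₁R : r₁ ≤ L)
    (hPNr : M * (kq + 3) ≤ Pr.N) (hAr : Pr.A = (Mz + 1 : ℕ) * (shearUnit nL hL : ℤ) + 1)
    (hdDr : Pr.d + 2 ≤ shellD Pr) (hDρr : Rs + 1 ≤ shellD Pr) (hKCmaxr : (shellD Pr + Mz + 1) * (kq + 1) ≤ KCmaxr)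
    (hwider : ∀ k ≤ Nr, ∀ j, j₀₂ ≤ j → j ≤ j₁₂ → ∀ i, ((yRunSched hnL hvL hlay R's qB Nr).lo k - (j : Site 2)) i + 2 * tanOff Pr.ℓs Pr.M ≤
      ((yRunSched hnL hvL hlay R's qB Nr).hi k + (j : Site 2)) i)
    (hdwr : ∀ k ≤ Nr, ∀ j, j₀₂ ≤ j → j ≤ j₁₂ → ∀ i, ((yRunSched hnL hvL hlay R's qB Nr).lo k - (j : Site 2)) i + (Pr.d + 2 : ℕ) ≤
      ((yRunSched hnL hvL hlay R's qB Nr).hi k + (j : Site 2)) i)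
    (hDwr : ∀ k ≤ Nr, ∀ j, j₀₂ ≤ j → j ≤ j₁₂ → ∀ i, ((yRunSched hnL hvL hlay R's qB Nr).lo k - (j : Site 2)) i + ((shellD Pr + 1 + Pr.d + Pr.N * KCmaxr + Rs : ℕ) : ℤ) ≤
      ((yRunSched hnL hvL hlay R's qB Nr).hi k + (j : Site 2)) i)
    (hwidey : ∀ k ≤ N₃, ∀ j, j₀₃ ≤ j → j ≤ j₁₃ → ∀ i, ((xRunSched nL ℓ' hL R'₃ qB₃ N₃).lo k - (j : Site 2)) i + 2 * tanOff Pr.ℓs Pr.M ≤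
      ((xRunSched nL ℓ' hL R'₃ qB₃ N₃).hi k + (j : Site 2)) i)
    (hdwy : ∀ k ≤ N₃, ∀ j, j₀₃ ≤ j → j ≤ j₁₃ → ∀ i, ((xRunSched nL ℓ' hL R'₃ qB₃ N₃).lo k - (j : Site 2)) i + (Pr.d + 2 : ℕ) ≤
      ((xRunSched nL ℓ' hL R'₃ qB₃ N₃).hi k + (j : Site 2)) i)
    (hDwy : ∀ k ≤ N₃, ∀ j, j₀₃ ≤ j → j ≤ j₁₃ → ∀ i, ((xRunSched nL ℓ' hL R'₃ qB₃ N₃).lo k - (j : Site 2)) i + ((shellD Pr + 1 + Pr.d + Pr.N * KCmaxr + Rs : ℕ) : ℤ) ≤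
      ((xRunSched nL ℓ' hL R'₃ qB₃ N₃).hi k + (j : Site 2)) i)
    (hT'r : (shellD Pr : ℤ) + Pr.N * KCmaxr + Rs ≤ tanOff Pr.ℓs Pr.M)
    (hr₀r : Pr.N * (tanOff Pr.ℓs Pr.M + 2) + Pr.N * Pr.d + (Pr.N * KCmaxr + Rs) ≤ Pr.r₀) (hRr₀ : Pr.r₀ ≤ L)
    (hrsr : 1 + (Pr.N * (tanOff Pr.ℓs Pr.M + 2) + Pr.N * Pr.d + (Pr.N * KCmaxr + Rs)) ≤ rsr)
    (hcSr : (Pr.N + 1) * (tanOff Pr.ℓs Pr.M + 1) + (Pr.N + 1) * Pr.d + (KCmaxr + 1) * (Pr.N + 2) + cU ≤ cSr)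
    (hEr : j₁₂ + (Pr.N * (tanOff Pr.ℓs Pr.M + 1) + Pr.N * Pr.d + Pr.N * KCmaxr) ≤ R's)
    (hEy : j₁₃ + (Pr.N * (tanOff Pr.ℓs Pr.M + 1) + Pr.N * Pr.d + Pr.N * KCmaxr) ≤ R'₃)
    (hreachr : r₂ + (Pr.N * (tanOff Pr.ℓs Pr.M + 1) + Pr.N * Pr.d + Pr.N * KCmaxr) ≤ Pr.r₀) (hr₂ : Rl ≤ r₂) (hr₂R : r₂ ≤ L)
    -- the short region and the zone datum at the kit centres (inside `Rg`, connected from the centre inside itself, containing the centre and the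
    -- fat-prism zone box of record `cylBallFin c kz Rk`, `Rk ≥ cylRadMax types kz (2·KCmax)` of both kits)
    (Rg : V → Finset V) (hRg : ∀ c', ∀ u ∈ Rg c', u ∈ graphBall G c' Rs) (hRgcard : ∀ c', (Rg c').card ≤ cU) (hcU1 : 1 ≤ cU)
    (Λc : V → ℕ → Finset V) (kz : ℕ) (hΛRg : ∀ c', Λc c' kz ⊆ Rg c') (hzconn : ∀ c', ∀ s ∈ Λc c' kz, PathIn G (↑(Λc c' kz) : Set V) c' s)
    (hcz : ∀ c', c' ∈ Λc c' kz)

    (hclr : (Mz + 4) * (nL + hL.natAbs) ≤ nL * (ℓ' + 1))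
    -- the bridge stride at every centre: region, piece, readings in the root frame
    (Qb Fb : V → Finset V)
    (hQb : ∀ c', ∀ w ∈ Qb c', w ∈ graphBall G c' Rb ∧
      rootFrame φ c σh w ∈ Finset.Icc (rootFrame φ c σh c' - ((B.pr : ℕ) : Site 2)) (rootFrame φ c σh c' + ((B.pr : ℕ) : Site 2)))
    (hFb : ∀ c', ∀ w ∈ Fb c', w ∈ Qb c' ∧ rootFrame φ c σh w ∈ Finset.Icc (rootFrame φ c σh c' + B.dlo) (rootFrame φ c σh c' + B.dhi))
    -- contact-count budgets of the three kits
    (kk₁ kk₂ kk₃ : ℕ) (hkN₁ : kk₁ * (Δg + 1) ^ (2 * rsb) ≤ N₁) (hkN₂ : kk₂ * (Δg + 1) ^ (2 * rsr) ≤ N₂) (hkN₃ : kk₃ * (Δg + 1) ^ (2 * rsr) ≤ N₃')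
    (hk₁ : (1 - (q : ℝ) ^ (1 + Δg * cSb + cSb * cU)) ^ kk₁ ≤ δ) (hk₂ : (1 - (q : ℝ) ^ (1 + Δg * cSr + cSr * cU)) ^ kk₂ ≤ δ)
    (hk₃ : (1 - (q : ℝ) ^ (1 + Δg * cSr + cSr * cU)) ^ kk₃ ≤ δ)
    -- THE STEP-I‴ INPUTS AT EVERY CENTRE (all for `P_q`, accuracy `δ³`): the bridge event, the long x-links, the long y′-links
    (hbridge : ∀ c', 1 - δ ^ 3 < (bondPercolation G q).real (linkIn (↑(Qb c') : Set V) (Λc c' kz) (Fb c')))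
    (hlongx : ∀ c' (τ : ℤ), τ = 1 ∨ τ = -1 → 1 - δ ^ 3 < (bondPercolation G q).real
      (linkIn (pgramPrism G φ c' nL hL (3 * ℓ') Rl) (Λc c' kz) (pgSideHalfW G φ c' nL hL ℓ' Rl σT (σT * τ))))
    (hlongy : ∀ c' (τ : ℤ), τ = 1 ∨ τ = -1 → 1 - δ ^ 3 < (bondPercolation G q).real
      (linkIn (pgramPrism G φ c' nL hL (3 * ℓ') Rl) (Λc c' kz) (pgTopPieceW G φ c' nL hL ℓ' Rl σ τ vL)))
    -- the planar diameter `m` of the step region `D`; the excess radius at entrance depth `ρ` (the seed's radius about `c`), centre-uniform, below both rim radii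
    {m : ℕ} (hDm : ∀ d ∈ D, ∀ d' ∈ D, φ d - φ d' ∈ box 2 m)
    {R₁ : ℕ}
    (hR₁ : ∀ (c' : V) (R' : ℕ), R₁ ≤ R' → ∀ (Rw : ℕ) (D' B' : Finset V), (∀ d ∈ D', d ∈ graphBall G c' Rw) →
      (∀ d ∈ D', ∀ d' ∈ D', φ d - φ d' ∈ box 2 m) → B' ⊆ D' → (∀ a ∈ B', a ∈ graphBall G c' ρ) →
        (bondPercolation G q).real (excess G c' R' D' B') ≤ η)
    (hR₁b : R₁ ≤ L - Pb.r₀) (hR₁r : R₁ ≤ L - Pr.r₀) :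
    ∃ Qt Ft : Finset V, Ft ⊆ T ∧ Qt ⊆ D ∧ Disjoint Ft Z ∧ 1 - ε < (prodBernoulli Wt).real (linkIn (↑Qt : Set V) S Ft) := by
  set Qt := D.filter fun y => y ∈ graphBall G c L with hQt
  set ψL := runY φ cL nL hL σ with hψL
  set ψT := runX φ cT nL hL σT with hψT
  have hlipR : Lip G (rootFrame φ c σh) := lip_rootFrame hlipφ c hσh
  have hlipL : Lip G ψL := lip_runY hlipφ hσ hnL cL hL
  have hlipT : Lip G ψT := lip_runX hlipφ hσT hnL cT hL
  set 𝒲₁ := planarWindowWin hlipR c L with h𝒲₁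
  set 𝒲₂ := planarWindowWin hlipL c L with h𝒲₂
  set 𝒲₃ := planarWindowWin hlipT c L with h𝒲₃
  set S₁ := B.bridgeFrame hB with hS₁
  set SN := yRunSched hnL hvL hlay R's qB Nr with hSN
  set SY := xRunSched nL ℓ' hL R'₃ qB₃ N₃ with hSY
  set S₂ : SchedFrame := SN.toFrame with hS₂
  set S₃ : SchedFrame := SY.toFrame with hS₃
  -- the chain data: rims are the far parts of the region windows
  set P₁ : WinChainData V := ⟨Rlev₁, N₁, j₀₁, j₁₁, c, Qt, fun k => rootRim c L Pb.r₀ (𝒲₁.stepDF S₁ k)⟩ with hP₁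
  set P₂ : WinChainData V := ⟨Rlev₂, N₂, j₀₂, j₁₂, c, Qt, fun k => rootRim c L Pr.r₀ (𝒲₂.stepDF S₂ k)⟩ with hP₂
  set P₃ : WinChainData V := ⟨Rlev₃, N₃', j₀₃, j₁₃, c, Qt, fun k => rootRim c L Pr.r₀ (𝒲₃.stepDF S₃ k)⟩ with hP₃
  have hS₂N : S₂.N = Nr := rfl
  have hS₂R : S₂.R' = R's := rfl
  have hS₃N : S₃.N = N₃ := rfl
  have hS₃R : S₃.R' = R'₃ := rfl
  -- the inner ball inside the outer ball; the world
  have hball : ∀ {w : V}, w ∈ graphBall G c L → w ∈ graphBall G w₀ Rπ := by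
    intro w hw
    have h2 := BoxProdZ2.mem_graphBall_add G hcL hw
    rwa [Nat.sub_add_cancel hLπ] at h2
  have hQD : Qt ⊆ D := Finset.filter_subset _ _
  have hQL : ∀ u ∈ Qt, u ∈ graphBall G c L := fun u hu => (Finset.mem_filter.1 hu).2
  have hW : ∀ {w : V}, w ∈ graphBall G c L → ψc w ∈ Pl → w ∈ Qt := by
    intro w hw hf
    exact Finset.mem_filter.2 ⟨hPlD ((mem_Win G ψc).2 ⟨hball hw, hf⟩), hw⟩
  have hSQ : S ⊆ Qt := fun s hs => Finset.mem_filter.2 ⟨hSD hs, graphBall_mono G c hρL (hSρ s hs)⟩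
  -- regions: inside the world, off the seed
  have hDQ₁ : ∀ k ≤ S₁.N, 𝒲₁.stepDF S₁ k ⊆ Qt := by
    intro k hk w hw
    obtain rfl : k = 0 := Nat.le_zero.1 hk
    change w ∈ Win G (rootFrame φ c σh) c (S₁.region 0) L at hw
    rw [mem_Win] at hw
    exact hW hw.1 (hfoot₁ w hw.1 (by simpa [hS₁] using hw.2))
  have hDQ₂ : ∀ k ≤ S₂.N, 𝒲₂.stepDF S₂ k ⊆ Qt := by
    intro k hk w hw
    change w ∈ Win G ψL c (S₂.region k) L at hw
    rw [mem_Win] at hw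
    exact hW hw.1 (hfoot₂ k hk w hw.1 hw.2)
  have hDQ₃ : ∀ k ≤ S₃.N, 𝒲₃.stepDF S₃ k ⊆ Qt := by
    intro k hk w hw
    change w ∈ Win G ψT c (S₃.region k) L at hw
    rw [mem_Win] at hw
    exact hW hw.1 (hfoot₃ k hk w hw.1 hw.2)
  have hDS₁ : ∀ k ≤ S₁.N, Disjoint S (𝒲₁.stepDF S₁ k) := by
    intro k hk
    obtain rfl : k = 0 := Nat.le_zero.1 hk
    change Disjoint S (Win G (rootFrame φ c σh) c (S₁.region 0) L)
    refine Finset.disjoint_left.2 fun w hwS hw => ?_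
    rw [mem_Win] at hw
    have h1 : B.B₀lo 0 - B.R' - B.pr ≤ rootFrame φ c σh w 0 := BridgePrm.le_of_mem_region (by simpa [hS₁] using hw.2) 0
    have h2 := (abs_le.1 (hSk w hwS)).2
    linarith
  have hDS₂ : ∀ k ≤ S₂.N, Disjoint S (𝒲₂.stepDF S₂ k) := by
    intro k hk
    change Disjoint S (Win G ψL c (S₂.region k) L)
    refine Finset.disjoint_left.2 fun w hwS hw => ?_
    rw [mem_Win] at hw
    exact hclear₂ k hk w hw.1 hw.2 hwS
  have hDS₃ : ∀ k ≤ S₃.N, Disjoint S (𝒲₃.stepDF S₃ k) := by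
    intro k hk
    change Disjoint S (Win G ψT c (S₃.region k) L)
    refine Finset.disjoint_left.2 fun w hwS hw => ?_
    rw [mem_Win] at hw
    exact hclear₃ k hk w hw.1 hw.2 hwS
  -- the subbox weightings of the region windows under the route law
  have hWD₁ : ∀ k ≤ S₁.N, IsSubbox (winGraph G c L) (routeW G Wt Qt S) q (𝒲₁.stepDF S₁ k) := fun k hk =>
    isSubbox_routeW_stepDF hlipR hWG hWD hDπ hQD hQL (hDQ₁ k hk) (hDS₁ k hk)
  have hWD₂ : ∀ k ≤ S₂.N, IsSubbox (winGraph G c L) (routeW G Wt Qt S) q (𝒲₂.stepDF S₂ k) := fun k hk =>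
    isSubbox_routeW_stepDF hlipL hWG hWD hDπ hQD hQL (hDQ₂ k hk) (hDS₂ k hk)
  have hWD₃ : ∀ k ≤ S₃.N, IsSubbox (winGraph G c L) (routeW G Wt Qt S) q (𝒲₃.stepDF S₃ k) := fun k hk =>
    isSubbox_routeW_stepDF hlipT hWG hWD hDπ hQD hQL (hDQ₃ k hk) (hDS₃ k hk)
  -- planar diameter of the route world in `φ` (a sub-region of `D`)
  have hQm : ∀ d ∈ Qt, ∀ d' ∈ Qt, φ d - φ d' ∈ box 2 m := fun d hd d' hd' => hDm d (hQD hd) d' (hQD hd')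
  -- rim excesses under the route law
  have hexc₁ : ∀ k ≤ S₁.N, (prodBernoulli (routeW G Wt Qt S)).real (⋃ t' ∈ P₁.Rim k, openConn c t') ≤ η := fun k hk => by
    show (prodBernoulli (routeW G Wt Qt S)).real (⋃ t' ∈ rimF hlipR c L S₁ (L - Pb.r₀) k, openConn c t') ≤ η
    exact real_rimF_routeW_le hlipR hWD hDπ hQD hQL hQm hSQ hcS hSρ hR₁ hR₁b (hDQ₁ k hk) (hDS₁ k hk)
  have hexc₂ : ∀ k ≤ S₂.N, (prodBernoulli (routeW G Wt Qt S)).real (⋃ t' ∈ P₂.Rim k, openConn c t') ≤ η := fun k hk => by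
    show (prodBernoulli (routeW G Wt Qt S)).real (⋃ t' ∈ rimF hlipL c L S₂ (L - Pr.r₀) k, openConn c t') ≤ η
    exact real_rimF_routeW_le hlipL hWD hDπ hQD hQL hQm hSQ hcS hSρ hR₁ hR₁r (hDQ₂ k hk) (hDS₂ k hk)
  have hexc₃ : ∀ k ≤ S₃.N, (prodBernoulli (routeW G Wt Qt S)).real (⋃ t' ∈ P₃.Rim k, openConn c t') ≤ η := fun k hk => by
    show (prodBernoulli (routeW G Wt Qt S)).real (⋃ t' ∈ rimF hlipT c L S₃ (L - Pr.r₀) k, openConn c t') ≤ η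
    exact real_rimF_routeW_le hlipT hWD hDπ hQD hQL hQm hSQ hcS hSρ hR₁ hR₁r (hDQ₃ k hk) (hDS₃ k hk)
  -- the kits of the bridge step
  have hkits₁ : SegKitsF (routeW G Wt Qt S) q δ P₁ 𝒲₁ S₁ := by
    intro k hk j hj
    obtain rfl : k = 0 := Nat.le_zero.1 hk
    have hjle : j ≤ j₁₁ := (Finset.mem_Icc.1 hj).2
    have hj0 : j₀₁ ≤ j := (Finset.mem_Icc.1 hj).1
    have hXD : winLevel G (rootFrame φ c σh) c L B.B₀lo B.B₀hi j ⊆ 𝒲₁.stepDF S₁ 0 := by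
      change Win G (rootFrame φ c σh) c (Finset.Icc (B.B₀lo - (j : Site 2)) (B.B₀hi + (j : Site 2))) L ⊆ Win G (rootFrame φ c σh) c (S₁.region 0) L
      refine Win_mono G _ ?_ le_rfl
      rw [hS₁, BridgePrm.bridgeFrame_region]
      exact (S₁.icc_enlarge_mono 0 (show j ≤ B.R' by omega)).trans BridgePrm.enl_subset_region
    have hPD : Win G (rootFrame φ c σh) c (Finset.Icc B.regionLo B.regionHi) L ⊆ 𝒲₁.stepDF S₁ 0 := subset_rfl
    have hPT : Win G (rootFrame φ c σh) c (Finset.Icc B.core1Lo B.core1Hi) L ⊆ P₁.coreEF 𝒲₁ S₁ 0 := Finset.subset_union_left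
    have hfarT : ∀ v ∈ winLevel G (rootFrame φ c σh) c L B.B₀lo B.B₀hi j, v ∉ graphBall G c (L - Pb.r₀) → v ∈ P₁.coreEF 𝒲₁ S₁ 0 :=
      fun v hv hfar => Finset.mem_union_right _ (Finset.mem_filter.2 ⟨hXD hv, hfar⟩)
    exact hkits_bridgeFC_q hlipφ hqφ hΔg hδ c hσh B Pb hPNb hAb hdDb hDρb hKCmaxb (hwideb j hj0 hjle) (hdwb j hj0 hjle)
      (hDwb j hj0 hjle) hT'b hr₀b hRb₀ hrsb hcSb (le_trans (by omega) hEb) hreachb hr₁ hr₁R Rg hRg hRgcard hcU1 Λc kz hΛRg hzconn hcz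
           Qb Fb hQb hFb kk₁ c Qt (hWD₁ 0 le_rfl) hPD hXD hPT hfarT hkN₁ hk₁ hbridge
  -- the kits of the along run
  have hkits₂ : SegKitsF (routeW G Wt Qt S) q δ P₂ 𝒲₂ S₂ := by
    intro k hk j hj
    have hjle : j ≤ j₁₂ := (Finset.mem_Icc.1 hj).2
    have hj0 : j₀₂ ≤ j := (Finset.mem_Icc.1 hj).1
    have hXD : winLevel G ψL c L (SN.lo k) (SN.hi k) j ⊆ 𝒲₂.stepDF S₂ k := by
      change Win G ψL c (Finset.Icc (SN.lo k - (j : Site 2)) (SN.hi k + (j : Site 2))) L ⊆ Win G ψL c (S₂.region k) L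
      exact Win_mono G _ ((S₂.icc_enlarge_mono k (show j ≤ S₂.R' by rw [hS₂R]; omega)).trans (S₂.encl k hk)) le_rfl
    have hPD : Win G ψL c (SN.region k) L ⊆ 𝒲₂.stepDF S₂ k := subset_rfl
    have hPT : Win G ψL c (SN.core (k + 1)) L ⊆ P₂.coreEF 𝒲₂ S₂ k := Finset.subset_union_left
    have hfarT : ∀ v ∈ winLevel G ψL c L (SN.lo k) (SN.hi k) j, v ∉ graphBall G c (L - Pr.r₀) → v ∈ P₂.coreEF 𝒲₂ S₂ k :=
      fun v hv hfar => Finset.mem_union_right _ (Finset.mem_filter.2 ⟨hXD hv, hfar⟩)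
    exact hkits_runYFC_q hlipφ hqφ hΔg hδ hnL cL hL hσ hκL hvL hlay R's qB Nr Pr hPNr hAr hdDr hDρr hKCmaxr
      (hwider k hk j hj0 hjle) (hdwr k hk j hj0 hjle) (hDwr k hk j hj0 hjle) hT'r hr₀r hRr₀ hrsr hcSr (le_trans (by omega) hEr) hreachr hr₂ hr₂R
      Rg hRg hRgcard hcU1 Λc kz hΛRg hzconn hcz hclr kk₂ c Qt (hWD₂ k hk) hPD hXD hPT hfarT hkN₂ hk₂ hlongy
  -- the kits of the tangential run
  have hkits₃ : SegKitsF (routeW G Wt Qt S) q δ P₃ 𝒲₃ S₃ := by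
    intro k hk j hj
    have hjle : j ≤ j₁₃ := (Finset.mem_Icc.1 hj).2
    have hj0 : j₀₃ ≤ j := (Finset.mem_Icc.1 hj).1
    have hXD : winLevel G ψT c L (SY.lo k) (SY.hi k) j ⊆ 𝒲₃.stepDF S₃ k := by
      change Win G ψT c (Finset.Icc (SY.lo k - (j : Site 2)) (SY.hi k + (j : Site 2))) L ⊆ Win G ψT c (S₃.region k) L
      exact Win_mono G _ ((S₃.icc_enlarge_mono k (show j ≤ S₃.R' by rw [hS₃R]; omega)).trans (S₃.encl k hk)) le_rfl
    have hPD : Win G ψT c (SY.region k) L ⊆ 𝒲₃.stepDF S₃ k := subset_rfl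
    have hPT : Win G ψT c (SY.core (k + 1)) L ⊆ P₃.coreEF 𝒲₃ S₃ k := Finset.subset_union_left
    have hfarT : ∀ v ∈ winLevel G ψT c L (SY.lo k) (SY.hi k) j, v ∉ graphBall G c (L - Pr.r₀) → v ∈ P₃.coreEF 𝒲₃ S₃ k :=
      fun v hv hfar => Finset.mem_union_right _ (Finset.mem_filter.2 ⟨hXD hv, hfar⟩)
    exact hkits_runXFC_q hlipφ hqφ hΔg hδ hnL cT hL hσT hκL ℓ' R'₃ qB₃ N₃ Pr hPNr hAr hdDr hDρr hKCmaxr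
      (hwidey k hk j hj0 hjle) (hdwy k hk j hj0 hjle) (hDwy k hk j hj0 hjle) hT'r hr₀r hRr₀ hrsr hcSr (le_trans (by omega) hEy) hreachr hr₂ hr₂R
      Rg hRg hRgcard hcU1 Λc kz hΛRg hzconn hcz kk₃ c Qt (hWD₃ k hk) hPD hXD hPT hfarT hkN₃ hk₃ hlongx
  -- assemble
  exact faceRoute_of_bridge₄F hlipφ hlipL hlipT hWG hWD hDπ hcL hLπ hPlD hMT hMZ hcS hSconn hSD (fun s hs => graphBall_mono G c hρL (hSρ s hs)) hσh hSk
    B hB S₂ S₃ P₁ P₂ P₃ rfl rfl rfl rfl rfl rfl (fun k => rootRim_subset c L Pb.r₀ _) (fun k => rootRim_subset c L Pr.r₀ _)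
    (fun k => rootRim_subset c L Pr.r₀ _) hRl₁ hRl₂ hRl₃ hj₁ hj₂ hj₃ hfoot₁ hfoot₂ hfoot₃ hclear₁ hclear₂ hclear₃ hTne₁ hTne₂ hTne₃ hx₁₂ hx₂₃ hlastf
    hUD hUL hS₀ hSU hT₀ hlink hchain hcount₁ hcount₂ hcount₃ hkits₁ hkits₂ hkits₃ hη hexc₁ hexc₂ hexc₃

end Skelφ

end Summit.CriticalPhenomena.PercolationContinuityZ3.Theorems.Transplant

end
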